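import Summits.CriticalPhenomena.SAWScalingLimit.Theorems.SAWLoopFugacityFlowAvoidanceLimitDeterminantalConfigs
import Summits.CriticalPhenomena.SAWScalingLimit.Theorems.SAWLoopFugacityFlowAvoidanceLimitDeterminantalLoops

/-!
# Closed strands of paths and polygons — helper file 4/5 of stub `stub_determinantal` of line
`symplectic-fermion-anchor` (crux `SAWLoopFugacityFlow.AvoidanceLimit`, stmt-CriticalPhenomena-10649)

On a subgraph `H ≤ ℤ²`: a simple polygon (a self-avoiding path closed up by an edge of `H`) carries
exactly ONE closed strand (`loops_cycle_eq_one`); a collision-free configuration with two sources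
`{a, b}` contains the edge set of a self-avoiding path from `a` to `b`, vertex-disjoint from the rest
(`exists_path_of_mem_cfConfigs`, the `loops`-free analogue of the tree's `exists_path_of_loopfree`);
hence removing the first edge of the open strand keeps `loops` (`loops_erase_source_edge`) and
removing an edge of a source-free configuration (opening a polygon) lowers it by one
(`loops_erase_cycle_edge`). Folklore (Jacobsen, LNP 775, §14.3.1: strands of the O(`n`) model);
no definitions.
-/

noncomputable section

open scoped BigOperators Topology symmDiff
open Filter Finset
open Literature.Probability.RandomPlanarGeometry Literature.Probability.LatticeModels

namespace Summit.CriticalPhenomena.SAWScalingLimit.Theorems.AvoidanceLimit.Anchor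

namespace DetExpansion

-- Local notations only (NO auxiliary definitions): indicator `[u ∼ v]`, `K_Λ = 1 - xA`, degree,
-- collision-free configurations, weight `x^{|F|}(-2)^{loops}`, `Z_{⟨-2,0,x⟩}` — whichever occur below.
local notation "deg[" F ", " z "]" => Finset.card (Finset.filter (fun e => z ∈ e) F)
local notation "cfC[" H ", " S ", " A "]" =>
  Finset.filter (fun F => DiluteLoopModel.oscVerts S F = ∅) (DiluteLoopModel.configs H S A)

/-! ## Closed strands of paths and polygons; the open strand of a two-source configuration -/

section Strands

open DiluteLoopModel SimpleGraph

variable {H : SimpleGraph (Site 2)}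

/-- **A simple polygon carries exactly one closed strand**: the edge set of a self-avoiding path
`p : v → u` of `H ≤ ℤ²` closed up by the edge `{v, u}` of `H` has `loops = 1`. [folklore] -/
theorem loops_cycle_eq_one (hH : H ≤ zdGraph 2) {Λ : Finset (Site 2)} {v u : Site 2} {p : H.Walk v u}
    (hp : p.IsPath) (hΛ : ∀ z ∈ p.support, z ∈ Λ) (hvu : H.Adj v u) (he : s(v, u) ∉ p.edges.toFinset) :
    loops Λ (insert s(v, u) p.edges.toFinset) ∅ = 1 := by
  classical
  have hne : v ≠ u := hvu.ne
  have hlatp : ∀ e ∈ p.edges.toFinset, e ∈ (zdGraph 2).edgeSet := edges_toFinset_lattice hH p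
  -- the reference half-edge at the start
  obtain ⟨e₁, he₁, hve₁⟩ : ∃ e ∈ p.edges.toFinset, v ∈ e := by
    have : #(p.edges.toFinset.filter fun e => v ∈ e) ≠ 0 := by
      rw [IsPath.card_filter_mem_edges_start hp hne]; exact one_ne_zero
    obtain ⟨e, he⟩ := card_pos.1 (Nat.pos_of_ne_zero this)
    exact ⟨e, (mem_filter.1 he).1, (mem_filter.1 he).2⟩
  obtain ⟨w, rfl⟩ := Sym2.mem_iff_exists.1 hve₁
  have hadj₁ : (zdGraph 2).Adj v w := by simpa using hlatp _ he₁
  obtain ⟨d₀, rfl⟩ := Dir.zdGraph_adj_iff_exists_vec.1 hadj₁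
  have hd₀ : hedge (v, d₀) ∈ p.edges.toFinset := he₁
  set C := insert s(v, u) p.edges.toFinset with hC
  have hlat : ∀ e ∈ C, e ∈ (zdGraph 2).edgeSet := by
    intro e he'
    rw [hC, mem_insert] at he'
    rcases he' with rfl | he'
    · exact (mem_edgeSet _).2 (hH hvu)
    · exact hlatp e he'
  have hsupp : ∀ e ∈ C, ∀ z ∈ e, z ∈ p.support := by
    intro e he' z hz
    rw [hC, mem_insert] at he'
    rcases he' with rfl | he'
    · rcases Sym2.mem_iff.1 hz with rfl | rfl
      · exact p.start_mem_support
      · exact p.end_mem_support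
    · exact Walk.mem_support_iff_exists_mem_edges.2 (Or.inr ⟨e, List.mem_toFinset.1 he', hz⟩)
  have hdeg2 : ∀ z ∈ p.support, deg[C, z] = 2 := by
    intro z hz
    rw [hC, deg_insert he]
    by_cases hzv : z = v
    · subst hzv
      rw [IsPath.card_filter_mem_edges_start hp hne, if_pos (Sym2.mem_mk_left _ _)]
    · by_cases hzu : z = u
      · subst hzu
        rw [IsPath.card_filter_mem_edges_end hp hne, if_pos (Sym2.mem_mk_right _ _)]
      · have hzn : z ∉ s(v, u) := by
          rw [Sym2.mem_iff]
          rintro (h | h)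
          · exact hzv h
          · exact hzu h
        rw [if_neg hzn, add_zero]
        have h2 := IsPath.card_filter_mem_edges_le_two hp z
        have hodd := IsPath.odd_card_filter_mem_edges_iff hp hne z
        have hne0 : #(p.edges.toFinset.filter fun e => z ∈ e) ≠ 0 := by
          rcases Walk.mem_support_iff_exists_mem_edges.1 hz with h | ⟨e, he', hze⟩
          · exact absurd h hzu
          · exact card_ne_zero_of_mem (mem_filter.2 ⟨List.mem_toFinset.2 he', hze⟩)
        have hnodd : ¬Odd #(p.edges.toFinset.filter fun e => z ∈ e) := fun h => by
          rcases hodd.1 h with h | h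
          · exact hzv h
          · exact hzu h
        rw [Nat.not_odd_iff_even] at hnodd
        obtain ⟨k, hk⟩ := hnodd
        omega
  have hdeg0 : ∀ z ∉ p.support, deg[C, z] = 0 := fun z hz =>
    deg_eq_zero_iff.2 fun e he' hze => hz (hsupp e he' z hze)
  have hldeg : ∀ z, ldeg C z ≤ 2 := fun z => by
    rw [ldeg_eq_deg hlat]
    by_cases hz : z ∈ p.support
    · rw [hdeg2 z hz]
    · rw [hdeg0 z hz]; exact zero_le_two
  have hmatched : ∀ y ∈ darts Λ C, IsMatched C ∅ y := fun y hy => by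
    have hyC := (mem_darts.1 hy).2
    refine isMatched_of_ldeg_eq_two hyC ?_
    rw [ldeg_eq_deg hlat, hdeg2 _ (hsupp _ hyC _ (fst_mem_hedge y))]
  have hreach : ∀ y ∈ darts Λ C, (strandGraph C ∅).Reachable y (v, d₀) := by
    intro y hy
    have hyC := (mem_darts.1 hy).2
    have hmono : strandGraph p.edges.toFinset ∅ ≤ strandGraph C ∅ :=
      strandGraph_mono (subset_insert _ _) hldeg
    rw [hC, mem_insert] at hyC
    rcases hyC with hye | hye
    · obtain ⟨d₁, hu⟩ := exists_dir_of_adj hH hvu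
      have hd₁ : hedge (v, d₁) = s(v, u) := by rw [hu]; rfl
      have hd₁C : hedge (v, d₁) ∈ C := by rw [hd₁, hC]; exact mem_insert_self _ _
      have hd₀C : hedge (v, d₀) ∈ C := mem_insert_of_mem hd₀
      have hne₁ : d₁ ≠ d₀ := fun h => he (by rw [← hd₁, h]; exact hd₀)
      have hpair : IsPaired C ∅ v d₁ d₀ := ⟨hne₁, hd₁C, hd₀C, fun h3 => by have := hldeg v; omega⟩
      have h1 : (strandGraph C ∅).Reachable (v, d₁) (v, d₀) := (strandGraph_adj_of_isPaired hpair).reachable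
      rcases eq_or_eq_flip_of_hedge_eq (hye.trans hd₁.symm) with rfl | rfl
      · exact h1
      · exact (strandGraph_adj_flip (S := ∅) hd₁C).symm.reachable.trans h1
    · exact (reachable_start_of_mem_edges hH hp y d₀ hye hd₀).mono hmono
  have hv : v ∈ Λ := hΛ _ p.start_mem_support
  have hy₀ : ((v, d₀) : Site 2 × Dir) ∈ darts Λ C := mem_darts.2 ⟨hv, mem_insert_of_mem hd₀⟩
  unfold loops
  rw [card_eq_one]
  refine ⟨(strandGraph C ∅).connectedComponentMk (v, d₀), ?_⟩
  ext c
  simp only [mem_image, mem_filter, mem_singleton]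
  constructor
  · rintro ⟨y, ⟨hy, -⟩, rfl⟩
    exact ConnectedComponent.eq.2 (hreach y hy)
  · rintro rfl
    exact ⟨(v, d₀), ⟨hy₀, fun y' hy' _ => hmatched y' hy'⟩, rfl⟩

/-- The path and the rest of a two-source configuration are vertex-disjoint. [folklore] -/
theorem vdisjoint_path_sdiff {a b : Site 2} {p : H.Walk a b} {F : Finset (Sym2 (Site 2))}
    (havoid : ∀ e ∈ F, e ∉ p.edges.toFinset → ∀ z ∈ p.support, z ∉ e) {P : Finset (Sym2 (Site 2))}
    (hP : ∀ e ∈ P, ∀ z ∈ e, z ∈ p.support) :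
    ∀ z : Site 2, ∀ e₁ ∈ P, ∀ e₂ ∈ F \ p.edges.toFinset, z ∈ e₁ → z ∉ e₂ := by
  intro z e₁ he₁ e₂ he₂ hz₁ hz₂
  rw [Finset.mem_sdiff] at he₂
  exact havoid e₂ he₂.1 he₂.2 z (hP e₁ he₁ z hz₁) hz₂

/-- Endpoints of edges of a walk lie on its support. [folklore] -/
theorem mem_support_of_mem_edges_toFinset {a b : Site 2} (p : H.Walk a b) :
    ∀ e ∈ p.edges.toFinset, ∀ z ∈ e, z ∈ p.support := fun e he _ hz =>
  Walk.mem_support_iff_exists_mem_edges.2 (Or.inr ⟨e, List.mem_toFinset.1 he, hz⟩)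

/-- The edge set of a self-avoiding path has no closed strand (any volume). [folklore] -/
theorem loops_path_eq_zero (hH : H ≤ zdGraph 2) {Λ : Finset (Site 2)} {a b : Site 2} {p : H.Walk a b}
    (hp : p.IsPath) (ha : a ∈ Λ) : loops Λ p.edges.toFinset ∅ = 0 := by
  by_cases hab : a = b
  · subst hab
    rw [Walk.isPath_iff_nil, ← Walk.eq_nil_iff_nil] at hp
    subst hp
    simp
  · exact loops_edges_eq_zero hH hp hab ha

variable [H.LocallyFinite]

/-- **The open strand of a collision-free two-source configuration**: a collision-free admissible
`F` with sources `{a, b}` (`a ≠ b`) on `H ≤ ℤ²` contains the edge set of a self-avoiding path of `H`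
from `a` to `b` inside the volume, and no other edge of `F` touches that path. [folklore] -/
theorem exists_path_of_mem_cfConfigs (hH : H ≤ zdGraph 2) {S : Finset (Site 2)} {b : Site 2} :
    ∀ (n : ℕ) (F : Finset (Sym2 (Site 2))) (a : Site 2), #F = n → a ≠ b → F ∈ cfC[H, S, {a} ∆ {b}] →
      ∃ p : H.Walk a b, p.IsPath ∧ (∀ z ∈ p.support, z ∈ S) ∧ p.edges.toFinset ⊆ F ∧
        ∀ e ∈ F, e ∉ p.edges.toFinset → ∀ z ∈ p.support, z ∉ e := by
  intro n
  induction n using Nat.strong_induction_on with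
  | _ n ih =>
  intro F a hn hab hF
  obtain ⟨hsub, hAS, hdeg⟩ := (mem_cfConfigs_iff hH).1 hF
  have haA : a ∈ ({a} ∆ {b} : Finset (Site 2)) := by simp [mem_symmDiff, hab]
  have hbA : b ∈ ({a} ∆ {b} : Finset (Site 2)) := by simp [mem_symmDiff, Ne.symm hab]
  have ha : a ∈ S := hAS haA
  have hb : b ∈ S := hAS hbA
  have hdega : deg[F, a] = 1 := (hdeg a ha).1 haA
  have hdegb : deg[F, b] = 1 := (hdeg b hb).1 hbA
  obtain ⟨v, hav, hvS, he₀⟩ := exists_adj_of_deg_ne_zero hsub (by rw [hdega]; exact one_ne_zero)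
  have huniq : ∀ e ∈ F, a ∈ e → e = s(a, v) := fun e he hae =>
    eq_of_deg_le_one hdega.le he hae he₀ (Sym2.mem_mk_left _ _)
  by_cases hvb : v = b
  · subst hvb
    refine ⟨Walk.cons hav Walk.nil, Walk.IsPath.nil.cons (by simp [hab]), ?_, ?_, ?_⟩
    · intro z hz
      simp only [Walk.support_cons, Walk.support_nil, List.mem_cons, List.not_mem_nil, or_false] at hz
      rcases hz with rfl | rfl
      · exact ha
      · exact hvS
    · intro e he'
      simp only [Walk.edges_cons, Walk.edges_nil, List.toFinset_cons, List.toFinset_nil,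
        insert_empty_eq, mem_singleton] at he'
      rw [he']; exact he₀
    · intro e he hne z hz
      simp only [Walk.edges_cons, Walk.edges_nil, List.toFinset_cons, List.toFinset_nil,
        insert_empty_eq, mem_singleton] at hne
      simp only [Walk.support_cons, Walk.support_nil, List.mem_cons, List.not_mem_nil, or_false] at hz
      rcases hz with rfl | rfl
      · exact fun hze => hne (huniq e he hze)
      · exact fun hze => hne (eq_of_deg_le_one hdegb.le he hze he₀ (Sym2.mem_mk_right _ _))
  · set F₁ := F.erase s(a, v) with hF₁def
    have hcard : #F₁ < n := by
      rw [hF₁def, card_erase_of_mem he₀, hn]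
      exact Nat.sub_one_lt (by rw [← hn]; exact card_ne_zero_of_mem he₀)
    have hF₁ : F₁ ∈ cfC[H, S, {v} ∆ {b}] := by
      refine erase_mem_cfConfigs hH hF he₀ Subset.rfl (fun z hz => ?_) (fun e he z hz => ?_)
        (fun z _ hz => ?_) (fun z _ hz => ?_)
      · rw [mem_symmDiff, mem_singleton, mem_singleton] at hz
        rcases hz with ⟨rfl, -⟩ | ⟨rfl, -⟩
        · exact hvS
        · exact hb
      · exact (mem_edgesIn_iff.1 (hsub (mem_erase.1 he).2)).2 z hz
      · have hza : z ≠ a := fun h => hz (h ▸ Sym2.mem_mk_left _ _)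
        have hzv : z ≠ v := fun h => hz (h ▸ Sym2.mem_mk_right _ _)
        simp [mem_symmDiff, hza, hzv]
      · rcases Sym2.mem_iff.1 hz with rfl | rfl
        · simp [mem_symmDiff, hab, hav.ne]
        · simp [mem_symmDiff, hvb, Ne.symm hav.ne]
    obtain ⟨p₁, hp₁, hp₁S, hp₁E, hp₁avoid⟩ := ih _ hcard F₁ v rfl hvb hF₁
    have haF₁ : ∀ e ∈ F₁, a ∉ e := fun e he hae =>
      (mem_erase.1 he).1 (huniq e (mem_erase.1 he).2 hae)
    have haS : a ∉ p₁.support := fun has => by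
      rcases Walk.mem_support_iff_exists_mem_edges.1 has with h | ⟨e, he, hae⟩
      · exact hab h
      · exact haF₁ e (hp₁E (List.mem_toFinset.2 he)) hae
    refine ⟨Walk.cons hav p₁, hp₁.cons haS, ?_, ?_, ?_⟩
    · intro z hz
      rw [Walk.support_cons, List.mem_cons] at hz
      rcases hz with rfl | hz
      · exact ha
      · exact hp₁S z hz
    · intro e he'
      rw [Walk.edges_cons, List.toFinset_cons, mem_insert] at he'
      rcases he' with rfl | he'
      · exact he₀
      · exact (mem_erase.1 (hp₁E he')).2
    · intro e he hne z hz
      rw [Walk.edges_cons, List.toFinset_cons, mem_insert, not_or] at hne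
      rw [Walk.support_cons, List.mem_cons] at hz
      rcases hz with rfl | hz
      · exact fun hze => hne.1 (huniq e he hze)
      · exact hp₁avoid e (mem_erase.2 ⟨hne.1, he⟩) hne.2 z hz

/-- **Removing the first edge of the open strand does not change `loops`.** [folklore] -/
theorem loops_erase_source_edge (hH : H ≤ zdGraph 2) {S : Finset (Site 2)} {a b u : Site 2}
    {F : Finset (Sym2 (Site 2))} (hab : a ≠ b) (hF : F ∈ cfC[H, S, {a} ∆ {b}]) (hu : s(a, u) ∈ F) :
    loops S F ∅ = loops S (F.erase s(a, u)) ∅ := by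
  obtain ⟨p, hp, hpS, hpE, havoid⟩ := exists_path_of_mem_cfConfigs hH _ F a rfl hab hF
  have ha : a ∈ S := hpS _ p.start_mem_support
  -- the edge at `a` is the first edge of `p`
  have hmem : s(a, u) ∈ p.edges.toFinset := by
    by_contra h
    exact havoid _ hu h a p.start_mem_support (Sym2.mem_mk_left _ _)
  cases p with
  | nil => exact absurd rfl hab
  | cons hav p' =>
    rename_i v
    rw [Walk.cons_isPath_iff] at hp
    have hp'E : s(a, v) ∉ p'.edges.toFinset := fun h =>
      hp.2 (Walk.fst_mem_support_of_mem_edges p' (List.mem_toFinset.1 h))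
    have huv : s(a, u) = s(a, v) := by
      rw [Walk.edges_cons, List.toFinset_cons, mem_insert] at hmem
      rcases hmem with h | h
      · exact h
      · exact absurd (Walk.fst_mem_support_of_mem_edges p' (List.mem_toFinset.1 h)) hp.2
    rw [huv]
    have hdj := vdisjoint_path_sdiff havoid (mem_support_of_mem_edges_toFinset (Walk.cons hav p'))
    have hdj' : ∀ z : Site 2, ∀ e₁ ∈ p'.edges.toFinset, ∀ e₂ ∈ F \ (Walk.cons hav p').edges.toFinset,
        z ∈ e₁ → z ∉ e₂ :=
      fun z e₁ he₁ e₂ he₂ hz₁ hz₂ => hdj z e₁ (by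
        rw [Walk.edges_cons, List.toFinset_cons]; exact mem_insert_of_mem he₁) e₂ he₂ hz₁ hz₂
    have hF₁ : F = (Walk.cons hav p').edges.toFinset ∪ (F \ (Walk.cons hav p').edges.toFinset) := by
      rw [union_sdiff_of_subset hpE]
    have hF₂ : F.erase s(a, v) = p'.edges.toFinset ∪ (F \ (Walk.cons hav p').edges.toFinset) := by
      conv_lhs => rw [hF₁]
      rw [Walk.edges_cons, List.toFinset_cons, erase_union_distrib, erase_insert hp'E,
        erase_eq_of_notMem]
      rw [Finset.mem_sdiff, not_and, not_not]
      exact fun _ => mem_insert_self _ _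
    rw [hF₂, loops_union hdj']
    conv_lhs => rw [hF₁]
    rw [loops_union hdj, loops_path_eq_zero hH (hp.1.cons hp.2) ha,
      loops_path_eq_zero hH hp.1 (hpS _ (by simp))]

/-- **Removing an edge from a simple polygon of a source-free configuration removes exactly one
closed strand.** [folklore] -/
theorem loops_erase_cycle_edge (hH : H ≤ zdGraph 2) {S : Finset (Site 2)} {v u : Site 2}
    {F : Finset (Sym2 (Site 2))} (hF : F ∈ cfC[H, S, ∅]) (he : s(v, u) ∈ F) :
    loops S F ∅ = loops S (F.erase s(v, u)) ∅ + 1 := by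
  have hsub := subset_of_mem_cfConfigs hF
  have heH := mem_edgesIn_iff.1 (hsub he)
  have hvu : H.Adj v u := by simpa using heH.1
  have hv : v ∈ S := heH.2 v (Sym2.mem_mk_left _ _)
  have huS : u ∈ S := heH.2 u (Sym2.mem_mk_right _ _)
  have hF' : F.erase s(v, u) ∈ cfC[H, S, {v} ∆ {u}] := by
    refine erase_mem_cfConfigs hH hF he Subset.rfl (fun z hz => ?_) (fun e he' z hz => ?_)
      (fun z _ hz => ?_) (fun z _ hz => ?_)
    · rw [mem_symmDiff, mem_singleton, mem_singleton] at hz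
      rcases hz with ⟨rfl, -⟩ | ⟨rfl, -⟩
      · exact hv
      · exact huS
    · exact (mem_edgesIn_iff.1 (hsub (mem_erase.1 he').2)).2 z hz
    · have hzv : z ≠ v := fun h => hz (h ▸ Sym2.mem_mk_left _ _)
      have hzu : z ≠ u := fun h => hz (h ▸ Sym2.mem_mk_right _ _)
      simp [mem_symmDiff, hzv, hzu]
    · rcases Sym2.mem_iff.1 hz with rfl | rfl
      · simp [mem_symmDiff, hvu.ne]
      · simp [mem_symmDiff, Ne.symm hvu.ne]
  obtain ⟨p, hp, hpS, hpE, havoid⟩ := exists_path_of_mem_cfConfigs hH _ _ v rfl hvu.ne hF'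
  have hep : s(v, u) ∉ p.edges.toFinset := fun h => notMem_erase _ _ (hpE h)
  set R := F.erase s(v, u) \ p.edges.toFinset with hR
  have hdj : ∀ z : Site 2, ∀ e₁ ∈ p.edges.toFinset, ∀ e₂ ∈ R, z ∈ e₁ → z ∉ e₂ :=
    vdisjoint_path_sdiff havoid (mem_support_of_mem_edges_toFinset p)
  have hdjC : ∀ z : Site 2, ∀ e₁ ∈ insert s(v, u) p.edges.toFinset, ∀ e₂ ∈ R,
      z ∈ e₁ → z ∉ e₂ := by
    refine vdisjoint_path_sdiff havoid fun e he' z hz => ?_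
    rw [mem_insert] at he'
    rcases he' with rfl | he'
    · rcases Sym2.mem_iff.1 hz with rfl | rfl
      · exact p.start_mem_support
      · exact p.end_mem_support
    · exact mem_support_of_mem_edges_toFinset p e he' z hz
  have h1 : F.erase s(v, u) = p.edges.toFinset ∪ R := by rw [hR, union_sdiff_of_subset hpE]
  have h2 : F = insert s(v, u) p.edges.toFinset ∪ R := by
    rw [insert_union, ← h1, insert_erase he]
  rw [h1, loops_union hdj]
  conv_lhs => rw [h2]
  rw [loops_union hdjC, loops_cycle_eq_one hH hp hpS hvu hep, loops_path_eq_zero hH hp hv]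
  ring

end Strands

end DetExpansion

/-- Registered sub-goal of this helper file (stub `stub_determinantal`, file 4/5): **opening a polygon
of a source-free collision-free configuration removes exactly one closed strand**. [folklore] -/
theorem loops_erase_edge_of_sourceFree :
    ∀ (H : SimpleGraph (Site 2)) [H.LocallyFinite], H ≤ zdGraph 2 →
      ∀ (S : Finset (Site 2)) (v u : Site 2) (F : Finset (Sym2 (Site 2))),
        F ∈ (DiluteLoopModel.configs H S ∅).filter (fun F => DiluteLoopModel.oscVerts S F = ∅) →
          s(v, u) ∈ F → DiluteLoopModel.loops S F ∅ = DiluteLoopModel.loops S (F.erase s(v, u)) ∅ + 1 :=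
  fun _ _ hH _ _ _ _ hF he => DetExpansion.loops_erase_cycle_edge hH hF he

end Summit.CriticalPhenomena.SAWScalingLimit.Theorems.AvoidanceLimit.Anchor

end
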